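import Summits.Langlands.Langlands.Theorems.IrreducibilityBySelfDualityReciprocityUpToIrreducibilityRankOneUnramified
import Literature.NumberTheory.Automorphic.CarayolCompatibilityOfLocalGlobalProofs
import HarnessLib

/-!
# Line `Sketch` for the crux `ReciprocityUpToIrreducibility` (item stmt-Langlands-14328), continuation c5:
# rank `n` — from unramified Weil–Deligne data back to the global representation (stub Cn
# `stub_isUnramifiedAt_and_hasFrobCharpolyAt_of_weilDeligne`)

Support file (closes nothing; registered stub `stub_isUnramifiedAt_and_hasFrobCharpolyAt_of_weilDeligne`
of line `Sketch`, wave 3 of continuation lead c5, prover-line-stmt-Langlands-14328-c5-0).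

The summit's local–global clause at a finite place `v ∤ ℓ` attaches to `ρ|_{W_{K_v}}`
(`ρ : Γ_K → GL_n(ℚ̄_ℓ)`) a Weil–Deligne representation `r_v` by the Grothendieck–Deligne recipe
(`IsWeilDeligneOfLadic`) and transports it along `ι : ℚ̄_ℓ ≃ ℂ` to `rℂ` (`IsTransportAlong`).  This
file is the way BACK, in every rank `n`: if `rℂ.N = 0`, `rℂ` is trivial on inertia and its geometric
Frobenii `Φ` (`deg Φ = -1`) have characteristic polynomial `∏_{a ∈ α} (X - a)`, then `ρ` is
unramified at `v` and every arithmetic Frobenius at `v` has characteristic polynomial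
`arithFrobPolyOfSatake ι q_v 1 α = ∏_{a ∈ α} (X - ι⁻¹(a⁻¹))`
(`isUnramifiedAt_and_hasFrobCharpolyAt_of_weilDeligne_wdBridge`; rank-2 template: the tree's
`FramedGaloisRep.isUnramifiedAt_and_hasFrobCharpolyAt_of_weilDeligne`, whose `charpolyRev` hypothesis
is replaced by the characteristic polynomial itself).  Steps: the transport is entrywise `ι`, which
is injective, so `r_v.N = 0` and `r_v` is unramified; the recipe with `N = 0` returns `ρ|_{W_{K_v}}`
itself on `W_{K_v} = Φ^ℤ · I_{K_v}` (`toMatrix'_eq_of_isWeilDeligneOfLadic_of_N_eq_zero_wdBridge`), so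
`ρ|_{Γ_{K_v}}` kills `I_{K_v}` and `ρ` is unramified at `v`
(`GaloisRep.isUnramifiedAt_iff_toLocal_holds`); `res(Φ⁻¹)` is an arithmetic Frobenius at the prime
`𝔓₀ ∣ v` cut out by the completion (`isArithFrobAt_absGaloisRestrict_adicCompletionPrime_iff`),
`char(M⁻¹) = ∏ (X - b⁻¹)` when `char(M) = ∏ (X - b)` (`charpoly_inv_of_charpoly_eq_prod`), and
Frobenii at `v` are conjugate modulo inertia (`IsUnramifiedAt.hasFrobCharpolyAt_charpoly`).
No definitions; std axioms.

References: J. Tate, *Number theoretic background*, Corvallis 1979, (4.1.3)–(4.2.1)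
[TateCorvallis1979]; J. Neukirch, *Algebraic Number Theory* (1999), Ch. II §9 Prop. (9.6)
[NeukirchANT1999]; J.-P. Serre, *Abelian ℓ-adic representations* (1968), Ch. I §2.1
[SerreAbelianLadic1968].
-/

noncomputable section

set_option linter.dupNamespace false -- project-wide option (lakefile weak.linter.dupNamespace); `Summit.Langlands.Langlands` is the mandated namespace

open scoped MatrixGroups Matrix NumberField Classical Polynomial
open Filter IsDedekindDomain Field Polynomial
open Literature.NumberTheory.Automorphic Literature.NumberTheory.GaloisRepresentations
open Literature.NumberTheory.PAdicHodge
open Summit.Langlands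

namespace Summit.Langlands.Langlands.Theorems.ReciprocityUpToIrreducibility

section LocalRecipe

variable {F : Type*} [Field F] [ValuativeRel F] [TopologicalSpace F] [IsNonarchimedeanLocalField F]
  {E : Type*} [Field E] [CharZero E] {n : ℕ}

/-- **The Grothendieck–Deligne recipe with `N = 0` returns `ρW` itself.**  If `r = (r.ρ, N)` is
attached to `ρW : W_F → GL_n(E)` by the recipe (`IsWeilDeligneOfLadic`: `[r.ρ(Φ^m u)] =
ρW(Φ^m u) · exp(-t(u) N)` for all `m ∈ ℤ`, `u ∈ I_F`, `deg Φ = -1`) and `r.N = 0`, then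
`[r.ρ(w)] = ρW(w)` for every `w ∈ W_F`, since `w = Φ^{-deg w} · (Φ^{deg w} w)` with
`Φ^{deg w} w ∈ I_F` (`WeilGroup.zpow_deg_mul_mem_inertia`) and `exp 0 = 1`.
[cite: TateCorvallis1979, (4.2.1)] [cite: DeligneAntwerpII1973, §8.4.2] -/
theorem toMatrix'_eq_of_isWeilDeligneOfLadic_of_N_eq_zero_wdBridge {ρW : WeilGroup F →* GL (Fin n) E}
    {r : WeilDeligneRep F E (Fin n → E)} (h : IsWeilDeligneOfLadic ρW r) (hN : r.N = 0)
    (w : WeilGroup F) :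
    LinearMap.toMatrix' (r.ρ w) = ((ρW w : GL (Fin n) E) : Matrix (Fin n) (Fin n) E) := by
  obtain ⟨t, U, Φ, -, -, hΦ, -, -, h3⟩ := h
  have hmem : Φ ^ (WeilGroup.deg w) * w ∈ WeilGroup.inertia F := WeilGroup.zpow_deg_mul_mem_inertia hΦ w
  have key := h3 (-WeilGroup.deg w) ⟨Φ ^ (WeilGroup.deg w) * w, hmem⟩
  have hw : Φ ^ (-WeilGroup.deg w) * (Φ ^ (WeilGroup.deg w) * w) = w := by
    rw [← mul_assoc, zpow_neg, inv_mul_cancel, one_mul]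
  simp only [hw, hN, map_zero, smul_zero, neg_zero, IsNilpotent.exp_zero, mul_one] at key
  exact key

/-- **The Grothendieck–Deligne recipe supplies a geometric Frobenius**: `IsWeilDeligneOfLadic ρW r`
records some `Φ ∈ W_F` with `deg Φ = -1`. [cite: TateCorvallis1979, (4.2.1)] -/
theorem exists_deg_eq_neg_one_of_isWeilDeligneOfLadic_wdBridge {ρW : WeilGroup F →* GL (Fin n) E}
    {r : WeilDeligneRep F E (Fin n → E)} (h : IsWeilDeligneOfLadic ρW r) :
    ∃ Φ : WeilGroup F, WeilGroup.deg Φ = -1 := by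
  obtain ⟨-, -, Φ, -, -, hΦ, -⟩ := h
  exact ⟨Φ, hΦ⟩

variable {C : Type*} [Field C] [CharZero C]

/-- **Transport along an injective `ι` reflects `N = 0`.**  If `r'` is `r` moved along the ring
homomorphism `ι : E → C` of fields (`IsTransportAlong`: matrices entrywise `ι`) and `r'.N = 0`, then
`r.N = 0` (`ι` is injective on matrices, `Matrix.map_injective`). [cite: DeligneAntwerpII1973, §8.4.3] -/
theorem N_eq_zero_of_isTransportAlong_wdBridge (ι : E →+* C) {r : WeilDeligneRep F E (Fin n → E)}
    {r' : WeilDeligneRep F C (Fin n → C)} (hT : r.IsTransportAlong ι r') (hN : r'.N = 0) :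
    r.N = 0 := by
  have h := hT.2
  rw [hN, map_zero] at h
  have h' : (LinearMap.toMatrix' r.N).map ι = (0 : Matrix (Fin n) (Fin n) E).map ι := by
    rw [← h, Matrix.map_zero _ (map_zero ι)]
  exact (LinearEquiv.map_eq_zero_iff LinearMap.toMatrix').mp (Matrix.map_injective ι.injective h')

/-- **Transport along an injective `ι` reflects unramifiedness.**  If `r'` is `r` moved along
`ι : E → C` and `r'.ρ` is trivial on `I_F`, so is `r.ρ` (`Matrix.map_injective`).
[cite: DeligneAntwerpII1973, §8.4.3] -/
theorem isUnramifiedRep_of_isTransportAlong_wdBridge (ι : E →+* C) {r : WeilDeligneRep F E (Fin n → E)}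
    {r' : WeilDeligneRep F C (Fin n → C)} (hT : r.IsTransportAlong ι r')
    (hur : WeilGroup.IsUnramifiedRep r'.ρ) : WeilGroup.IsUnramifiedRep r.ρ := by
  intro u hu
  have h := hT.1 u
  rw [hur u hu, LinearMap.toMatrix'_one] at h
  have h' : (LinearMap.toMatrix' (r.ρ u)).map ι = (1 : Matrix (Fin n) (Fin n) E).map ι := by
    rw [← h, Matrix.map_one _ (map_zero ι) (map_one ι)]
  have h'' := Matrix.map_injective ι.injective h'
  rw [← LinearMap.toMatrix'_one] at h''
  exact LinearMap.toMatrix'.injective h''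

end LocalRecipe

section RankNBridge

variable {K : Type} [Field K] [NumberField K] {ℓ : ℕ} [Fact ℓ.Prime] {n : ℕ}

/-- **From the Weil–Deligne data at `v` back to `ρ` (rank `n`).**  Let `ρ : Γ_K → GL_n(ℚ̄_ℓ)`, `v`
a finite place, `rv` attached to `ρ|_{W_{K_v}}` by the Grothendieck–Deligne recipe
(`IsWeilDeligneOfLadic`) and `rℂ` its transport along `ι : ℚ̄_ℓ ≃ ℂ`.  If `rℂ.N = 0`, `rℂ.ρ` is
unramified and `char(rℂ.ρ(Φ)) = ∏_{a ∈ α} (X - a)` for every geometric Frobenius `Φ` (`deg Φ = -1`),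
then `ρ` is unramified at `v` and every arithmetic Frobenius at `v` has characteristic polynomial
`∏_{a ∈ α} (X - ι⁻¹(a⁻¹)) = arithFrobPolyOfSatake ι q_v 1 α`: the recipe with `N = 0` returns
`ρ|_{W_{K_v}}` itself (Tate 1979, (4.2.1)), the transport is entrywise `ι`, `I_{𝔓₀} = res(I_{K_v})`
and `res(Φ⁻¹)` is an arithmetic Frobenius at the prime `𝔓₀ ∣ v` of the chosen embedding
(Neukirch, Ch. II (9.6)), `char(M⁻¹) = ∏ (X - b⁻¹)` when `char(M) = ∏ (X - b)`
(`charpoly_inv_of_charpoly_eq_prod`), and Frobenii at `v` are conjugate modulo inertia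
(`IsUnramifiedAt.hasFrobCharpolyAt_charpoly`, Serre, Ch. I §2.1).
[cite: TateCorvallis1979, (4.2.1)] [cite: NeukirchANT1999, Ch. II §9 Prop. (9.6)]
[cite: SerreAbelianLadic1968, Ch. I §2.1] -/
theorem isUnramifiedAt_and_hasFrobCharpolyAt_of_weilDeligne_wdBridge (ι : PadicAlgCl ℓ ≃+* ℂ)
    (ρ : FramedGaloisRep K (PadicAlgCl ℓ) n) (v : HeightOneSpectrum (𝓞 K))
    {rv : WeilDeligneRep (v.adicCompletion K) (PadicAlgCl ℓ) (Fin n → PadicAlgCl ℓ)}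
    {rℂ : WeilDeligneRep (v.adicCompletion K) ℂ (Fin n → ℂ)} {α : Multiset ℂ}
    (hWD : IsWeilDeligneOfLadic (ρ.toLocal v).toWeilGroupHom rv)
    (hT : rv.IsTransportAlong (ι : PadicAlgCl ℓ →+* ℂ) rℂ)
    (hN : rℂ.N = 0) (hur : WeilGroup.IsUnramifiedRep rℂ.ρ)
    (hch : ∀ Φ : WeilGroup (v.adicCompletion K), WeilGroup.deg Φ = -1 →
      (rℂ.ρ Φ).charpoly = (α.map fun a => X - C a).prod) :
    ρ.IsUnramifiedAt v ∧ ρ.HasFrobCharpolyAt v (arithFrobPolyOfSatake ι v.residueCard 1 α) := by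
  classical
  have hιinj : Function.Injective (ι : PadicAlgCl ℓ →+* ℂ) := (ι : PadicAlgCl ℓ →+* ℂ).injective
  -- (a) `rv.N = 0` and `rv.ρ` is unramified (transport along the injective `ι`)
  have hNv : rv.N = 0 := N_eq_zero_of_isTransportAlong_wdBridge _ hT hN
  have hurv : WeilGroup.IsUnramifiedRep rv.ρ := isUnramifiedRep_of_isTransportAlong_wdBridge _ hT hur
  -- (b) the recipe with `N = 0` returns `ρ|_{W_{K_v}}` itself
  have hρWeq : ∀ u : WeilGroup (v.adicCompletion K), LinearMap.toMatrix' (rv.ρ u) =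
      (((ρ.toLocal v).toWeilGroupHom u : GL (Fin n) (PadicAlgCl ℓ)) :
        Matrix (Fin n) (Fin n) (PadicAlgCl ℓ)) :=
    toMatrix'_eq_of_isWeilDeligneOfLadic_of_N_eq_zero_wdBridge hWD hNv
  -- (c) `ρ|_{Γ_{K_v}}` is trivial on inertia: `ρ` is unramified at `v`
  have hloc : ∀ σ ∈ absInertia (v.adicCompletion K), ρ.toLocal v σ = 1 := by
    intro σ hσ
    set u : WeilGroup (v.adicCompletion K) :=
      ⟨σ, absInertia_le_weilSubgroup (v.adicCompletion K) hσ⟩ with hu_def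
    have hu : u ∈ WeilGroup.inertia (v.adicCompletion K) := by
      rw [WeilGroup.mem_inertia_iff]; exact hσ
    have h : (ρ.toLocal v).toWeilGroupHom u = 1 := by
      refine Units.ext ?_
      rw [← hρWeq u, hurv u hu, LinearMap.toMatrix'_one, Units.val_one]
    rwa [FramedRep.toWeilGroupHom_apply] at h
  have hunr' : ρ.toGaloisRep.IsUnramifiedAt v := by
    refine (GaloisRep.isUnramifiedAt_iff_toLocal_holds v ρ.toGaloisRep).mpr fun σ hσ => ?_
    have h3 : FramedRep.toRepresentation ρ (absGaloisRestrict K (v.adicCompletion K) σ) = 1 := by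
      rw [FramedRep.toRepresentation_apply_eq_one_iff]
      exact hloc σ hσ
    exact h3
  have hunr : ρ.IsUnramifiedAt v := (ρ.isUnramifiedAt_toGaloisRep_iff v).mp hunr'
  refine ⟨hunr, ?_⟩
  -- (d) a geometric Frobenius `Φ` (from the recipe) and the arithmetic Frobenius `res(Φ⁻¹)` at `𝔓₀`
  obtain ⟨Φ, hΦ⟩ := exists_deg_eq_neg_one_of_isWeilDeligneOfLadic_wdBridge hWD
  set τ : absoluteGaloisGroup (v.adicCompletion K) := WeilGroup.toAbsGalois (v.adicCompletion K) Φ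
    with hτ
  have hτ' : IsFrobPow τ (-1) := by
    simpa [hΦ] using WeilGroup.isFrobPow_deg IsFrobPow.mul_holds Φ
  have hτinv : IsAbsArithFrob τ⁻¹ := by
    have h := hτ'.inv
    rw [neg_neg] at h
    exact isFrobPow_one_iff_isAbsArithFrob_holds.mp h
  have hq : IsNonarchimedeanLocalField.residueFieldCard (v.adicCompletion K) =
      Nat.card (𝓞 K ⧸ v.asIdeal) :=
    (residueFieldCard_adicCompletion_eq K v).trans (HeightOneSpectrum.residueCard_eq_card_quotient v)
  set σ : absoluteGaloisGroup K := absGaloisRestrict K (v.adicCompletion K) τ⁻¹ with hσ_def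
  have hσ : IsArithFrobAt (𝓞 K) σ (adicCompletionPrime K v) :=
    (isArithFrobAt_absGaloisRestrict_adicCompletionPrime_iff K v hq τ⁻¹).mpr hτinv
  -- (e) the matrices: `[rℂ.ρ Φ] = ι [ρ(Φ)]` and `ρ(σ) = ρ(Φ)⁻¹`
  set ME : Matrix (Fin n) (Fin n) (PadicAlgCl ℓ) :=
    (((ρ.toLocal v).toWeilGroupHom Φ : GL (Fin n) (PadicAlgCl ℓ)) :
      Matrix (Fin n) (Fin n) (PadicAlgCl ℓ)) with hME
  have hM : LinearMap.toMatrix' (rℂ.ρ Φ) = ME.map (ι : PadicAlgCl ℓ →+* ℂ) := by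
    rw [hT.1 Φ, hρWeq Φ]
  have hrσ : ((ρ σ : GL (Fin n) (PadicAlgCl ℓ)) : Matrix (Fin n) (Fin n) (PadicAlgCl ℓ)) = ME⁻¹ := by
    have h1 : ρ σ = ((ρ.toLocal v).toWeilGroupHom Φ)⁻¹ := by
      rw [hσ_def, ← FramedGaloisRep.toLocal_apply, map_inv, FramedRep.toWeilGroupHom_apply]
    rw [h1, Matrix.coe_units_inv]
  -- `char(ME) = ∏ (X - ι⁻¹ a)` since after `ι` it is `char(rℂ.ρ Φ) = ∏ (X - a)`
  have hchME : ME.charpoly = ((α.map fun a => ι.symm a).map fun c => X - C c).prod := by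
    rw [Multiset.map_map]
    apply Polynomial.map_injective (ι : PadicAlgCl ℓ →+* ℂ) hιinj
    rw [← Matrix.charpoly_map, ← hM, ← charpoly_eq_charpoly_toMatrix', hch Φ hΦ,
      Polynomial.map_multiset_prod, Multiset.map_map]
    refine congrArg _ (Multiset.map_congr rfl fun a _ => ?_)
    simp only [Function.comp_apply, Polynomial.map_sub, Polynomial.map_X, Polynomial.map_C,
      RingHom.coe_coe, RingEquiv.apply_symm_apply]
  -- `char(ρ σ) = char(ME⁻¹) = ∏ (X - (ι⁻¹ a)⁻¹) = arithFrobPolyOfSatake ι q_v 1 α`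
  have hcharE : FramedRep.charpoly ρ σ = arithFrobPolyOfSatake ι v.residueCard 1 α := by
    unfold FramedRep.charpoly
    rw [hrσ, Summit.Langlands.Langlands.Cruxes.MuOrdinaryFamilyRT.CharZeroDominance.charpoly_inv_of_charpoly_eq_prod
      (Units.isUnit _) hchME, arithFrobPolyOfSatake_one, Multiset.map_map]
    refine congrArg _ (Multiset.map_congr rfl fun a _ => ?_)
    simp only [Function.comp_apply, map_inv₀]
  -- (f) all Frobenii at all primes above `v`
  have hP := hunr'.hasFrobCharpolyAt_charpoly (adicCompletionPrime_mem_primesAbove K v) hσ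
  have hP' := (FramedGaloisRep.hasFrobCharpolyAt_toGaloisRep_iff v _ ρ).mp hP
  have hPeq : FramedRep.charpoly ρ σ = (ρ.toGaloisRep σ).charpoly :=
    hP' _ (adicCompletionPrime_mem_primesAbove K v) σ hσ
  rw [← hcharE, hPeq]
  exact hP'

/-- **Registered stub `stub_isUnramifiedAt_and_hasFrobCharpolyAt_of_weilDeligne` (Cn) of line `Sketch`
(crux stmt-Langlands-14328), closed form of
`isUnramifiedAt_and_hasFrobCharpolyAt_of_weilDeligne_wdBridge`**: from unramified Weil–Deligne data
(`rℂ.N = 0`, `rℂ` trivial on inertia, geometric Frobenii with characteristic polynomial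
`∏_{a ∈ α} (X - a)`) attached to `ρ|_{W_{K_v}}` by the Grothendieck–Deligne recipe and transported
along `ι`, back to `ρ` unramified at `v` with arithmetic-Frobenius characteristic polynomial
`arithFrobPolyOfSatake ι q_v 1 α`.  The hypothesis `∀ a ∈ α, a ≠ 0` of the registered signature is
not needed (it follows: `∏ ι⁻¹(a) = ± det` of an invertible matrix).
[cite: TateCorvallis1979, (4.2.1)] [cite: NeukirchANT1999, Ch. II §9 Prop. (9.6)]
[cite: SerreAbelianLadic1968, Ch. I §2.1] -/
theorem stub_isUnramifiedAt_and_hasFrobCharpolyAt_of_weilDeligne :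
    ∀ (K : Type) [Field K] [NumberField K] (ℓ : ℕ) [Fact ℓ.Prime] (n : ℕ) (ι : PadicAlgCl ℓ ≃+* ℂ)
      (ρ : FramedGaloisRep K (PadicAlgCl ℓ) n) (v : HeightOneSpectrum (𝓞 K))
      (rv : WeilDeligneRep (v.adicCompletion K) (PadicAlgCl ℓ) (Fin n → PadicAlgCl ℓ))
      (rℂ : WeilDeligneRep (v.adicCompletion K) ℂ (Fin n → ℂ)) (α : Multiset ℂ),
      IsWeilDeligneOfLadic (ρ.toLocal v).toWeilGroupHom rv →
      rv.IsTransportAlong (ι : PadicAlgCl ℓ →+* ℂ) rℂ →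
      rℂ.N = 0 → WeilGroup.IsUnramifiedRep rℂ.ρ → (∀ a ∈ α, a ≠ 0) →
      (∀ Φ : WeilGroup (v.adicCompletion K), WeilGroup.deg Φ = -1 →
        (rℂ.ρ Φ).charpoly = (α.map fun a => X - C a).prod) →
      ρ.IsUnramifiedAt v ∧ ρ.HasFrobCharpolyAt v (arithFrobPolyOfSatake ι v.residueCard 1 α) :=
  fun _ _ _ _ _ _ ι ρ v _ _ _ hWD hT hN hur _ hch =>
    isUnramifiedAt_and_hasFrobCharpolyAt_of_weilDeligne_wdBridge ι ρ v hWD hT hN hur hch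

end RankNBridge

end Summit.Langlands.Langlands.Theorems.ReciprocityUpToIrreducibility

end
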